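import Summits.BirchSwinnertonDyer.BirchSwinnertonDyer.Theorems.ByReductionTypeAtTwoTowerLambdaRankAdditive
import HarnessLib

/-!
# The `[2]`-part of `ker h_j`: gap and rank doors that charge the torsion bit to `#E(ℚ_∞)[2]`, not to
# `#E(ℚ_j)[2^∞]` — the `ℤ/4` classes of the INELIG block (route ByReductionTypeAtTwo, items 19577 / 19573;
# seat bsd-2adic-ord-3 GEN 7)

HONEST FRAMING (cell `bsd-2adic`, run/shared/lean/pub/bsd-2adic/, HUMAN RULINGS D-0036 / D-0054 / D-0074): THEOREMS
ONLY; nothing asserted; no definition; no named fact; closes nothing by itself.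

WHY. ord-2's KitE (`TowerLayer.natCard_layerClasses_le_mul`) and every door built on it (gap
`towerGapAtTwo_of_classCounts_of_torsion`, rank `TowerLambdaTorsion.towerRank_of_layerClasses_of_torsion`) bound
`#A_j[2] ≤ #ker h_j · #T_j` and then `#ker h_j = #E(ℚ_j)[2^∞] ≤ 2^t` (Greenberg Lemma 4.3). But `h_j` restricted to
the `2`-torsion `A_j[2]` has its kernel inside `(ker h_j)[2]`, and `ker h_j ≅ B/(γ_j − 1)B` (`B = E(ℚ_∞)[2^∞]`, tree
`kerLayerToInftyEquiv`, Greenberg Lemma 3.1) is a QUOTIENT of `B`, so `#(ker h_j)[2] ≤ #B[2] = #E(ℚ_∞)[2]`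
(§1: for a surjection `B ↠ Q` of finite abelian groups `#Q[2] = #(Q/2Q) ≤ #(B/2B) = #B[2]`). On a curve with
`E(ℚ)_tors ≅ ℤ/4` this charges ONE bit (`#E(ℚ_∞)[2] = 2` as soon as `√s ∉ ℚ_∞`) where the old doors charged two
(`#E(ℚ)[2^∞] = 4`). §3–§4: the refined counting lemma and the gap / rank doors with the hypothesis
`hinf : #{b ∈ E(ℚ_∞)[2^∞] : 2b = 0} ≤ 2^t` in place of `htor`. The certificate for `hinf` (one Frobenius prime
`ℓ ≡ ±1 (mod 8)` with `s` a non-residue) is the companion file `…TowerInfTwoTorsionCertificate.lean`.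
References: [GreenbergLNM1716] §3 Lemma 3.1 (p. 86), §4 Lemma 4.3 (p. 103); [Washington1997] §13.1.
-/

set_option autoImplicit false
-- the sub-problem namespace repeats the summit name by design (D-0017 nested layout)
set_option linter.dupNamespace false

noncomputable section

open scoped Classical

open WeierstrassCurve Literature.NumberTheory.EllipticCurves PowerSeries
  Summit.BirchSwinnertonDyer.Rank1Residual Summit.BirchSwinnertonDyer.Rank1Residual.X5.TowerGap

namespace Summit.BirchSwinnertonDyer.BirchSwinnertonDyer.Theorems.TowerLayer

/-! ## §1 Abelian groups: `#Q[2] ≤ #B[2]` for a quotient `Q` of a finite abelian group `B` -/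

section Abelian

/-- For a surjection `f : B ↠ Q` of abelian groups with `B` finite: `#Q[2] ≤ #B[2]`. Proof: `#X[2] = #(X/2X)`
(both equal `#X / #2X`) and `B/2B ↠ Q/2Q`. [folklore] -/
theorem natCard_twoTorsion_le_of_surjective {B Q : Type*} [AddCommGroup B] [AddCommGroup Q] [Finite B]
    (f : B →+ Q) (hf : Function.Surjective f) :
    Nat.card {q : Q // 2 • q = 0} ≤ Nat.card {b : B // 2 • b = 0} := by
  haveI : Finite Q := Finite.of_surjective f hf
  let dB : B →+ B := DistribSMul.toAddMonoidHom B (2 : ℕ)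
  let dQ : Q →+ Q := DistribSMul.toAddMonoidHom Q (2 : ℕ)
  -- `#X = #X[2] · #2X` and `#X = #(X/2X) · #2X`
  have hB1 : Nat.card B = Nat.card dB.ker * Nat.card dB.range := natCard_eq_natCard_ker_mul_natCard_range dB
  have hB2 : Nat.card B = Nat.card (B ⧸ dB.range) * Nat.card dB.range :=
    dB.range.card_eq_card_quotient_mul_card_addSubgroup
  have hQ1 : Nat.card Q = Nat.card dQ.ker * Nat.card dQ.range := natCard_eq_natCard_ker_mul_natCard_range dQ
  have hQ2 : Nat.card Q = Nat.card (Q ⧸ dQ.range) * Nat.card dQ.range :=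
    dQ.range.card_eq_card_quotient_mul_card_addSubgroup
  have hkB : Nat.card dB.ker = Nat.card (B ⧸ dB.range) :=
    Nat.eq_of_mul_eq_mul_right Nat.card_pos (hB1.symm.trans hB2)
  have hkQ : Nat.card dQ.ker = Nat.card (Q ⧸ dQ.range) :=
    Nat.eq_of_mul_eq_mul_right Nat.card_pos (hQ1.symm.trans hQ2)
  -- `B/2B ↠ Q/2Q`
  have hle : dB.range ≤ dQ.range.comap f := by
    rintro _ ⟨b, rfl⟩
    refine ⟨f b, ?_⟩
    simp only [dB, dQ, DistribSMul.toAddMonoidHom_apply, map_nsmul]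
  have hsurj : Function.Surjective (QuotientAddGroup.map dB.range dQ.range f hle) :=
    QuotientAddGroup.map_surjective_of_surjective dB.range dQ.range f
      ((QuotientAddGroup.mk'_surjective dQ.range).comp hf) hle
  have hquot : Nat.card (Q ⧸ dQ.range) ≤ Nat.card (B ⧸ dB.range) := Nat.card_le_card_of_surjective _ hsurj
  -- the `2`-torsion subtypes are the kernels
  have eB : Nat.card {b : B // 2 • b = 0} = Nat.card dB.ker :=
    Nat.card_congr (Equiv.subtypeEquivRight fun b ↦ by
      rw [AddMonoidHom.mem_ker, DistribSMul.toAddMonoidHom_apply])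
  have eQ : Nat.card {q : Q // 2 • q = 0} = Nat.card dQ.ker :=
    Nat.card_congr (Equiv.subtypeEquivRight fun q ↦ by
      rw [AddMonoidHom.mem_ker, DistribSMul.toAddMonoidHom_apply])
  rw [eB, eQ, hkB, hkQ]
  exact hquot

/-- `2`-torsion counts are invariant under `≃+`. [folklore] -/
theorem natCard_twoTorsion_congr {B Q : Type*} [AddCommGroup B] [AddCommGroup Q] (e : B ≃+ Q) :
    Nat.card {b : B // 2 • b = 0} = Nat.card {q : Q // 2 • q = 0} :=
  Nat.card_congr (e.toEquiv.subtypeEquiv fun b ↦ by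
    rw [AddEquiv.toEquiv_eq_coe, AddEquiv.coe_toEquiv, ← map_nsmul, AddEquiv.map_eq_zero_iff])

end Abelian

/-! ## §2 `#(ker h_n)[2] ≤ #E(ℚ_∞)[2]` -/

section Layer

variable (W : WeierstrassCurve ℚ) (κ : ZpExtension ℚ 2)

/-- **`#(ker h_n)[2] ≤ #E(ℚ_∞)[2^∞][2] = #E(ℚ_∞)[2]`**: `ker h_n ≅ B/(γ^{2ⁿ} − 1)B` with `B = E(ℚ_∞)[2^∞]`
(tree `kerLayerToInftyEquiv`, Greenberg Lemma 3.1), a quotient of the finite group `B`.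
[cite: GreenbergLNM1716, §3 Lemma 3.1 (p. 86), §4 Lemma 4.3 (p. 103)] -/
theorem natCard_kerTwoTorsion_le_natCard_infTwoTorsion (n : ℕ)
    [Finite (FixedPoints.addSubgroup κ.kerSubgroup (geomPrimaryTorsion W 2))] :
    Nat.card {k : (W.layerToInfty κ n).ker // 2 • k = 0} ≤
      Nat.card {b : FixedPoints.addSubgroup κ.kerSubgroup (geomPrimaryTorsion W 2) // 2 • b = 0} := by
  obtain ⟨γ, hγ⟩ := κ.surjective (Multiplicative.ofAdd 1)
  have hγ' : κ.IsTopGenerator γ := hγ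
  rw [natCard_twoTorsion_congr (W.kerLayerToInftyEquiv κ hγ' n)]
  exact natCard_twoTorsion_le_of_surjective (QuotientAddGroup.mk' _) (QuotientAddGroup.mk'_surjective _)

/-! ## §3 `#A_n[2] ≤ #(ker h_n)[2] · #T_n` -/

/-- **`#A_n[2] ≤ #(ker h_n)[2] · #T_n`** (`T_n = Sel_∞[2]^{γ^{2ⁿ}}`): KitE's `natCard_layerClasses_le_mul` with the
kernel of `h_n|_{A_n[2]}` placed inside the `2`-TORSION of `ker h_n` (it consists of `2`-torsion classes).
[cite: GreenbergLNM1716, §3 pp. 85–86 (Lemmas 3.1, 3.2)] -/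
theorem natCard_layerClasses_le_kerTwo_mul (γ : Field.absoluteGaloisGroup ℚ) (n : ℕ)
    (hfin : Finite (W.layerToInfty κ n).ker)
    (hT : Finite {s : W.selmerInfty κ // 2 • s = 0 ∧
      W.conjH1 2 κ.kerSubgroup (γ ^ 2 ^ n) (s : W.subgroupH1 2 κ.kerSubgroup) = s}) :
    Nat.card {z : W.selmerInftyPreimage κ n // 2 • z = 0} ≤
      Nat.card {k : (W.layerToInfty κ n).ker // 2 • k = 0} * Nat.card {s : W.selmerInfty κ // 2 • s = 0 ∧
        W.conjH1 2 κ.kerSubgroup (γ ^ 2 ^ n) (s : W.subgroupH1 2 κ.kerSubgroup) = s} := by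
  set L := W.subgroupH1 2 (κ.layerSubgroup n) with hL
  set h := W.layerToInfty κ n with hh
  let S : AddSubgroup L := W.selmerInftyPreimage κ n ⊓ (DistribSMul.toAddMonoidHom L 2).ker
  have hS : ∀ y : L, y ∈ S ↔ y ∈ W.selmerInftyPreimage κ n ∧ 2 • y = 0 := fun y ↦ by
    simp only [S, AddSubgroup.mem_inf, AddMonoidHom.mem_ker, DistribSMul.toAddMonoidHom_apply]
  have hSel : Nat.card {z : W.selmerInftyPreimage κ n // 2 • z = 0} = Nat.card S := by
    let g : {z : W.selmerInftyPreimage κ n // 2 • z = 0} → S := fun z ↦ ⟨(z.1 : L), (hS _).mpr ⟨z.1.2, by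
      rw [← AddSubgroup.coe_nsmul, z.2, AddSubgroup.coe_zero]⟩⟩
    refine Nat.card_congr (Equiv.ofBijective g ⟨?_, ?_⟩)
    · intro z z' hzz'
      have := congrArg (fun w : S ↦ (w : L)) hzz'
      exact Subtype.ext (Subtype.ext this)
    · rintro ⟨y, hy⟩
      obtain ⟨hy1, hy2⟩ := (hS y).mp hy
      exact ⟨⟨⟨y, hy1⟩, Subtype.ext (by rw [AddSubgroup.coe_nsmul, AddSubgroup.coe_zero]; exact hy2)⟩, rfl⟩
  let ψ : S →+ W.subgroupH1 2 κ.kerSubgroup := h.comp S.subtype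
  -- the refinement: `ker ψ ⊆ (ker h)[2]`
  have hψker : Nat.card ψ.ker ≤ Nat.card {k : h.ker // 2 • k = 0} := by
    haveI := hfin
    refine Nat.card_le_card_of_injective (fun y : ψ.ker ↦ (⟨⟨(y.1 : L), ?_⟩, ?_⟩ : {k : h.ker // 2 • k = 0})) ?_
    · have := (AddMonoidHom.mem_ker).mp y.2
      rw [AddMonoidHom.mem_ker]
      simpa [ψ] using this
    · apply Subtype.ext
      rw [AddSubgroup.coe_nsmul, AddSubgroup.coe_mk, AddSubgroup.coe_zero]
      exact ((hS _).mp y.1.2).2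
    · intro y y' hyy'
      have := congrArg (fun w : {k : h.ker // 2 • k = 0} ↦ ((w.1 : h.ker) : L)) hyy'
      exact Subtype.ext (Subtype.ext this)
  have hψrange : Nat.card ψ.range ≤ Nat.card {s : W.selmerInfty κ // 2 • s = 0 ∧
      W.conjH1 2 κ.kerSubgroup (γ ^ 2 ^ n) (s : W.subgroupH1 2 κ.kerSubgroup) = s} := by
    haveI := hT
    refine Nat.card_le_card_of_injective (fun x : ψ.range ↦ (⟨⟨x.1, ?_⟩, ?_, ?_⟩ : {s : W.selmerInfty κ //
      2 • s = 0 ∧ W.conjH1 2 κ.kerSubgroup (γ ^ 2 ^ n) (s : W.subgroupH1 2 κ.kerSubgroup) = s})) ?_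
    · obtain ⟨y, hy⟩ := x.2
      rw [← hy]
      exact (mem_selmerInftyPreimage_iff W κ n _).mp ((hS _).mp y.2).1
    · obtain ⟨y, hy⟩ := x.2
      apply Subtype.ext
      rw [AddSubgroup.coe_nsmul, AddSubgroup.coe_mk, ← hy]
      change 2 • h (y : L) = 0
      rw [← map_nsmul, ((hS _).mp y.2).2, map_zero]
    · obtain ⟨y, hy⟩ := x.2
      rw [AddSubgroup.coe_mk, ← hy]
      exact conjH1_pow_layerToInfty W κ γ n (y : L)
    · intro x x' hxx'
      have := congrArg (fun s : {s : W.selmerInfty κ // 2 • s = 0 ∧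
        W.conjH1 2 κ.kerSubgroup (γ ^ 2 ^ n) (s : W.subgroupH1 2 κ.kerSubgroup) = s} ↦
          ((s.1 : W.selmerInfty κ) : W.subgroupH1 2 κ.kerSubgroup)) hxx'
      exact Subtype.ext this
  rw [hSel, natCard_eq_natCard_ker_mul_natCard_range ψ]
  exact Nat.mul_le_mul hψker hψrange

end Layer

end Summit.BirchSwinnertonDyer.BirchSwinnertonDyer.Theorems.TowerLayer

/-! ## §4 The doors: gap and rank with the torsion bit read off `#E(ℚ_∞)[2]` -/

namespace Summit.BirchSwinnertonDyer.BirchSwinnertonDyer.Theorems.TowerClass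

open Summit.BirchSwinnertonDyer.Rank1Residual.X5.O1 Summit.BirchSwinnertonDyer.BirchSwinnertonDyer.Theorems

variable (W : WeierstrassCurve ℚ) [W.IsElliptic]

/-- **The gap from TWO layers `j ≤ j'`, `A`-currency lower count, torsion bit charged to `#E(ℚ_∞)[2]`.**
Granted `E(ℚ_∞)[2^∞]` finite (`hB` per `κ`): `2^a ≤ #A_j[2]`, `#A_{j'}[2] ≤ 2^d`,
`#{b ∈ E(ℚ_∞)[2^∞] : 2b = 0} ≤ 2^t` and `d + t + 1 ≤ 2^{j'} − 2^j + a` ⇒ `TowerGapAtTwo W`. Same proof as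
KitE's `towerGapAtTwo_of_classCounts_of_torsion` with §3 and §2 in place of `#ker h_j ≤ #E(ℚ_j)[2^∞]`.
[cite: GreenbergLNM1716, §1 p. 60 and p. 62, §3 pp. 85–86 (Lemma 3.1), §4 Lemma 4.3] -/
theorem towerGapAtTwo_of_classCounts_of_infTwoTorsion
    (hB : ∀ κ : ZpExtension ℚ 2, κ.IsCyclotomic →
      Finite (FixedPoints.addSubgroup κ.kerSubgroup (geomPrimaryTorsion W 2)))
    {j j' a d t : ℕ} (hjj' : j ≤ j')
    (hlow : ∀ κ : ZpExtension ℚ 2, κ.IsCyclotomic →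
      2 ^ a ≤ Nat.card {z : W.selmerInftyPreimage κ j // 2 • z = 0})
    (hinf : ∀ κ : ZpExtension ℚ 2, κ.IsCyclotomic →
      Nat.card {b : FixedPoints.addSubgroup κ.kerSubgroup (geomPrimaryTorsion W 2) // 2 • b = 0} ≤ 2 ^ t)
    (hup : ∀ κ : ZpExtension ℚ 2, κ.IsCyclotomic →
      Nat.card {z : W.selmerInftyPreimage κ j' // 2 • z = 0} ≤ 2 ^ d)
    (had : d + t + 1 ≤ 2 ^ j' - 2 ^ j + a) : TowerGapAtTwo W := by
  intro κ γ hκ hγ _ D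
  haveI : Module.Finite (IwasawaAlgebra 2) D.X := D.module_finite_holds hγ
  haveI := hB κ hκ
  have hfinj : Finite (W.layerToInfty κ j).ker := TowerLayer.finite_ker_layerToInfty W κ j
  have hfinj' : Finite (W.layerToInfty κ j').ker := TowerLayer.finite_ker_layerToInfty W κ j'
  have hTj : Finite {s : W.selmerInfty κ // 2 • s = 0 ∧
      W.conjH1 2 κ.kerSubgroup (γ ^ 2 ^ j) (s : W.subgroupH1 2 κ.kerSubgroup) = s} :=
    TowerLayer.finite_fixedPTorsion D j
  refine ⟨2 ^ j, 2 ^ j' - 2 ^ j, ?_⟩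
  rw [Nat.add_sub_cancel' (Nat.pow_le_pow_right (by norm_num) hjj')]
  have ej' : Nat.card (D.X ⧸ (towerIdeal 2 (2 ^ j') • ⊤ : Submodule (IwasawaAlgebra 2) D.X)) =
      Nat.card {s : W.selmerInfty κ // 2 • s = 0 ∧
        W.conjH1 2 κ.kerSubgroup (γ ^ 2 ^ j') (s : W.subgroupH1 2 κ.kerSubgroup) = s} := by
    rw [← KatoHalfPinch.layerIdeal_eq_towerIdeal, TowerLayer.natCard_quotient_layerIdeal_eq D j']
  have ej : Nat.card (D.X ⧸ (towerIdeal 2 (2 ^ j) • ⊤ : Submodule (IwasawaAlgebra 2) D.X)) =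
      Nat.card {s : W.selmerInfty κ // 2 • s = 0 ∧
        W.conjH1 2 κ.kerSubgroup (γ ^ 2 ^ j) (s : W.subgroupH1 2 κ.kerSubgroup) = s} := by
    rw [← KatoHalfPinch.layerIdeal_eq_towerIdeal, TowerLayer.natCard_quotient_layerIdeal_eq D j]
  have hK : Nat.card {k : (W.layerToInfty κ j).ker // 2 • k = 0} ≤ 2 ^ t :=
    (TowerLayer.natCard_kerTwoTorsion_le_natCard_infTwoTorsion W κ j).trans (hinf κ hκ)
  have h1 : 2 ^ a ≤ 2 ^ t * Nat.card {s : W.selmerInfty κ // 2 • s = 0 ∧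
      W.conjH1 2 κ.kerSubgroup (γ ^ 2 ^ j) (s : W.subgroupH1 2 κ.kerSubgroup) = s} :=
    (hlow κ hκ).trans ((TowerLayer.natCard_layerClasses_le_kerTwo_mul W κ γ j hfinj hTj).trans
      (Nat.mul_le_mul_right _ hK))
  rw [ej', ej]
  have key : 2 ^ t * 2 ^ d < 2 ^ t * (2 ^ (2 ^ j' - 2 ^ j) * Nat.card {s : W.selmerInfty κ // 2 • s = 0 ∧
      W.conjH1 2 κ.kerSubgroup (γ ^ 2 ^ j) (s : W.subgroupH1 2 κ.kerSubgroup) = s}) :=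
    calc 2 ^ t * 2 ^ d = 2 ^ (t + d) := (pow_add _ _ _).symm
      _ < 2 ^ (2 ^ j' - 2 ^ j + a) := Nat.pow_lt_pow_right (by norm_num) (by omega)
      _ = 2 ^ (2 ^ j' - 2 ^ j) * 2 ^ a := pow_add _ _ _
      _ ≤ 2 ^ (2 ^ j' - 2 ^ j) * (2 ^ t * Nat.card {s : W.selmerInfty κ // 2 • s = 0 ∧
          W.conjH1 2 κ.kerSubgroup (γ ^ 2 ^ j) (s : W.subgroupH1 2 κ.kerSubgroup) = s}) :=
        Nat.mul_le_mul_left _ h1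
      _ = 2 ^ t * (2 ^ (2 ^ j' - 2 ^ j) * Nat.card {s : W.selmerInfty κ // 2 • s = 0 ∧
          W.conjH1 2 κ.kerSubgroup (γ ^ 2 ^ j) (s : W.subgroupH1 2 κ.kerSubgroup) = s}) := by ring
  calc Nat.card {s : W.selmerInfty κ // 2 • s = 0 ∧
        W.conjH1 2 κ.kerSubgroup (γ ^ 2 ^ j') (s : W.subgroupH1 2 κ.kerSubgroup) = s}
      ≤ Nat.card {z : W.selmerInftyPreimage κ j' // 2 • z = 0} :=
        TowerLayer.natCard_fixedPTorsion_le_natCard_layerClasses_of_finite_ker W κ hγ j' hfinj'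
    _ ≤ 2 ^ d := hup κ hκ
    _ < _ := Nat.lt_of_mul_lt_mul_left key

/-- The same with Greenberg's named finiteness fact `hB`. [cite: GreenbergLNM1716, §1 p. 62, §4 Lemma 4.3] -/
theorem towerGapAtTwo_of_classCounts_of_infTwoTorsion_of_hB (hB : Greenberg1999.finite_torsion_cyclotomicZpExtension)
    {j j' a d t : ℕ} (hjj' : j ≤ j')
    (hlow : ∀ κ : ZpExtension ℚ 2, κ.IsCyclotomic →
      2 ^ a ≤ Nat.card {z : W.selmerInftyPreimage κ j // 2 • z = 0})
    (hinf : ∀ κ : ZpExtension ℚ 2, κ.IsCyclotomic →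
      Nat.card {b : FixedPoints.addSubgroup κ.kerSubgroup (geomPrimaryTorsion W 2) // 2 • b = 0} ≤ 2 ^ t)
    (hup : ∀ κ : ZpExtension ℚ 2, κ.IsCyclotomic →
      Nat.card {z : W.selmerInftyPreimage κ j' // 2 • z = 0} ≤ 2 ^ d)
    (had : d + t + 1 ≤ 2 ^ j' - 2 ^ j + a) : TowerGapAtTwo W :=
  towerGapAtTwo_of_classCounts_of_infTwoTorsion W (fun κ hκ ↦ hB W 2 κ hκ) hjj' hlow hinf hup had

end Summit.BirchSwinnertonDyer.BirchSwinnertonDyer.Theorems.TowerClass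

namespace Summit.BirchSwinnertonDyer.BirchSwinnertonDyer.Theorems.TowerLambdaTorsion

open Summit.BirchSwinnertonDyer.Rank1Residual.X5.O1 Summit.BirchSwinnertonDyer.BirchSwinnertonDyer.Theorems

variable (W : WeierstrassCurve ℚ) [W.IsElliptic]

/-- **RANK certificate, `A`-currency, torsion bit charged to `#E(ℚ_∞)[2]`.** Granted `E(ℚ_∞)[2^∞]` finite
(`hB` per `κ`): `#{b ∈ E(ℚ_∞)[2^∞] : 2b = 0} ≤ 2^t` and `2^{n+t} ≤ #A_j[2]` ⇒ for every cyclotomic datum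
`2^n ≤ #X/(2,T^{2^j})X`. Same proof as `towerRank_of_layerClasses_of_torsion` with the `[2]`-part of `ker h_j`.
[cite: GreenbergLNM1716, §1 p. 60 and p. 62, §3 pp. 85–86 (Lemma 3.1), §4 Lemma 4.3] -/
theorem towerRank_of_layerClasses_of_infTwoTorsion
    (hB : ∀ κ : ZpExtension ℚ 2, κ.IsCyclotomic →
      Finite (FixedPoints.addSubgroup κ.kerSubgroup (geomPrimaryTorsion W 2)))
    {j n t : ℕ}
    (hinf : ∀ κ : ZpExtension ℚ 2, κ.IsCyclotomic →
      Nat.card {b : FixedPoints.addSubgroup κ.kerSubgroup (geomPrimaryTorsion W 2) // 2 • b = 0} ≤ 2 ^ t)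
    (hlow : ∀ κ : ZpExtension ℚ 2, κ.IsCyclotomic →
      2 ^ (n + t) ≤ Nat.card {z : W.selmerInftyPreimage κ j // 2 • z = 0}) :
    ∀ (κ : ZpExtension ℚ 2) (γ : Field.absoluteGaloisGroup ℚ), κ.IsCyclotomic →
      κ.IsTopGenerator γ → IsCyclotomicVariable 2 γ → ∀ D : W.SelmerDualData κ γ,
      ∃ j' : ℕ, 2 ^ n ≤ Nat.card (D.X ⧸ (towerIdeal 2 j' • ⊤ : Submodule (IwasawaAlgebra 2) D.X)) := by
  intro κ γ hκ hγ _ D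
  haveI : Module.Finite (IwasawaAlgebra 2) D.X := D.module_finite_holds hγ
  haveI := hB κ hκ
  have hfinj : Finite (W.layerToInfty κ j).ker := TowerLayer.finite_ker_layerToInfty W κ j
  have hTj : Finite {s : W.selmerInfty κ // 2 • s = 0 ∧
      W.conjH1 2 κ.kerSubgroup (γ ^ 2 ^ j) (s : W.subgroupH1 2 κ.kerSubgroup) = s} :=
    TowerLayer.finite_fixedPTorsion D j
  refine ⟨2 ^ j, ?_⟩
  rw [← KatoHalfPinch.layerIdeal_eq_towerIdeal, TowerLayer.natCard_quotient_layerIdeal_eq D j]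
  have hK : Nat.card {k : (W.layerToInfty κ j).ker // 2 • k = 0} ≤ 2 ^ t :=
    (TowerLayer.natCard_kerTwoTorsion_le_natCard_infTwoTorsion W κ j).trans (hinf κ hκ)
  have h1 : 2 ^ n * 2 ^ t ≤ 2 ^ t * Nat.card {s : W.selmerInfty κ // 2 • s = 0 ∧
      W.conjH1 2 κ.kerSubgroup (γ ^ 2 ^ j) (s : W.subgroupH1 2 κ.kerSubgroup) = s} := by
    rw [← pow_add]
    exact (hlow κ hκ).trans ((TowerLayer.natCard_layerClasses_le_kerTwo_mul W κ γ j hfinj hTj).trans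
      (Nat.mul_le_mul_right _ hK))
  rw [mul_comm] at h1
  exact Nat.le_of_mul_le_mul_left h1 (by positivity)

end Summit.BirchSwinnertonDyer.BirchSwinnertonDyer.Theorems.TowerLambdaTorsion

end
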